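import Summits.KontsevichZagierPeriods.KontsevichZagierPeriods.Theorems.UnfoldedStokesStokesGenerationStubRungValue
import Mathlib.Analysis.SpecialFunctions.Log.Deriv
import Mathlib.Analysis.Calculus.Deriv.Polynomial
import Mathlib.Topology.Algebra.Polynomial
import Mathlib.MeasureTheory.Integral.IntervalIntegral.FundThmCalculus

/-!
# `StokesGeneration` (stmt-3586), line `fibrewise_stokes`, rung stub R6 — value of an exact-plus-dlog representation

The registered stub `stub_rungDlogValue` of the line `Cruxes/StokesGeneration/Lines/fibrewise_stokes.lean`
(dlog sector of the residual S2, rung 2): if `t` is an integral representation on the closed unit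
cube of `ℝ¹ = (Fin 1 → ℝ)` whose integrand agrees on the cube with
`z ↦ g₀ (z 0) + Σᵢ cᵢ pᵢ′(z 0)/pᵢ(z 0)`, where `G₀′ = g₀` on `[0,1]` (exact part, `g₀` continuous on
`[0,1]`) and the `pᵢ` are real polynomials positive on `[0,1]`, then
`t.value = (G₀ 1 − G₀ 0) + Σᵢ cᵢ log(pᵢ(1)/pᵢ(0))`.
Proof: transport the set integral over the cube of `ℝ¹` to `∫ y in Icc 0 1` (the landed helper
`setIntegral_cubePi_one_eq` of the sibling stub R1), pass to the interval integral, split the sum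
(every summand is continuous on `[0,1]`), and evaluate both pieces by FTC-2
(`intervalIntegral.integral_eq_sub_of_hasDerivAt`): `∫₀¹ g₀ = G₀ 1 − G₀ 0` and
`∫₀¹ pᵢ′/pᵢ = log pᵢ(1) − log pᵢ(0) = log(pᵢ(1)/pᵢ(0))` (`(log ∘ pᵢ)′ = pᵢ′/pᵢ` as `pᵢ > 0` on `[0,1]`).
[Kontsevich–Zagier 2001, §1.1]
-/

noncomputable section

set_option linter.dupNamespace false

namespace Summit.KontsevichZagierPeriods.KontsevichZagierPeriods.Cruxes.StokesGeneration.FibrewiseStokes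

open MeasureTheory Set
open Literature.NumberTheory.Transcendental
open Literature.NumberTheory.Transcendental.KZ

/-- **FTC for the exact part**: if `G₀` has derivative `g₀ u` at every `u ∈ [0,1]` and `g₀` is
continuous on `[0,1]`, then `∫₀¹ g₀ = G₀ 1 − G₀ 0`. [folklore] -/
theorem intervalIntegral_exactPart_eq_sub {G₀ g₀ : ℝ → ℝ}
    (hG : ∀ u ∈ Set.Icc (0:ℝ) 1, HasDerivAt G₀ (g₀ u) u) (hg : ContinuousOn g₀ (Set.Icc (0:ℝ) 1)) :
    ∫ y in (0:ℝ)..1, g₀ y = G₀ 1 - G₀ 0 := by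
  have hG' : ∀ u ∈ Set.uIcc (0:ℝ) 1, HasDerivAt G₀ (g₀ u) u := by
    rw [Set.uIcc_of_le zero_le_one]
    exact hG
  have hg' : ContinuousOn g₀ (Set.uIcc (0:ℝ) 1) := by
    rw [Set.uIcc_of_le zero_le_one]
    exact hg
  exact intervalIntegral.integral_eq_sub_of_hasDerivAt hG' hg'.intervalIntegrable

/-- The logarithmic derivative `p′/p` of a real polynomial positive on `[0,1]` is continuous on
`uIcc 0 1 = [0,1]`. [folklore] -/
theorem continuousOn_logDeriv_poly (p : Polynomial ℝ) (hp : ∀ u ∈ Set.Icc (0:ℝ) 1, 0 < p.eval u) :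
    ContinuousOn (fun u : ℝ => (Polynomial.derivative p).eval u / p.eval u) (Set.uIcc (0:ℝ) 1) := by
  rw [Set.uIcc_of_le zero_le_one]
  exact (Polynomial.continuousOn _).div (Polynomial.continuousOn _) (fun u hu => (hp u hu).ne')

/-- Each dlog summand `u ↦ c · p′(u)/p(u)` (`p > 0` on `[0,1]`) is interval integrable on `0..1`
(it is continuous on `[0,1]`). [folklore] -/
theorem intervalIntegrable_const_mul_logDeriv_poly (c : ℝ) (p : Polynomial ℝ)
    (hp : ∀ u ∈ Set.Icc (0:ℝ) 1, 0 < p.eval u) :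
    IntervalIntegrable (fun u : ℝ => c * ((Polynomial.derivative p).eval u / p.eval u)) volume 0 1 :=
  (continuousOn_const.mul (continuousOn_logDeriv_poly p hp)).intervalIntegrable

/-- **The elementary dlog integral**: for a real polynomial `p` positive on `[0,1]`,
`∫₀¹ c · p′(u)/p(u) du = c · log(p(1)/p(0))` (FTC-2 for `log ∘ p`, whose derivative is `p′/p`
because `p ≠ 0` on `[0,1]`, then `log p(1) − log p(0) = log(p(1)/p(0))`). [folklore] -/
theorem intervalIntegral_const_mul_logDeriv_poly (c : ℝ) (p : Polynomial ℝ)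
    (hp : ∀ u ∈ Set.Icc (0:ℝ) 1, 0 < p.eval u) :
    ∫ u in (0:ℝ)..1, c * ((Polynomial.derivative p).eval u / p.eval u) =
      c * Real.log (p.eval 1 / p.eval 0) := by
  have h1 : 0 < p.eval 1 := hp 1 ⟨zero_le_one, le_rfl⟩
  have h0 : 0 < p.eval 0 := hp 0 ⟨le_rfl, zero_le_one⟩
  have hderiv : ∀ u ∈ Set.uIcc (0:ℝ) 1,
      HasDerivAt (fun y : ℝ => Real.log (p.eval y)) ((Polynomial.derivative p).eval u / p.eval u) u := by
    rw [Set.uIcc_of_le zero_le_one]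
    intro u hu
    exact (Polynomial.hasDerivAt p u).log (hp u hu).ne'
  rw [intervalIntegral.integral_const_mul, Real.log_div h1.ne' h0.ne',
    intervalIntegral.integral_eq_sub_of_hasDerivAt hderiv (continuousOn_logDeriv_poly p hp).intervalIntegrable]

/-- STUB R6 (rung 2, dlog sector) **value of an exact-plus-dlog representation**: if
`t : IntegralRep 1` has domain the closed unit cube of `ℝ¹` and integrand agreeing there with
`z ↦ g₀ (z 0) + Σᵢ cᵢ pᵢ′(z 0)/pᵢ(z 0)`, where `G₀′ = g₀` on `[0,1]`, `g₀` is continuous on `[0,1]`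
and every `pᵢ` is a real polynomial positive on `[0,1]`, then
`t.value = (G₀ 1 − G₀ 0) + Σᵢ cᵢ log(pᵢ(1)/pᵢ(0))`
(transport `ℝ¹ → ℝ`, then FTC-2 for `G₀` and for `log ∘ pᵢ`). [cite: KontsevichZagier2001, §1.1] -/
theorem stub_rungDlogValue :
    ∀ (s : ℕ) (p : Fin s → Polynomial ℝ) (c : Fin s → ℝ) (G₀ g₀ : ℝ → ℝ),
      (∀ i, ∀ u ∈ Set.Icc (0:ℝ) 1, 0 < (p i).eval u) →
      (∀ u ∈ Set.Icc (0:ℝ) 1, HasDerivAt G₀ (g₀ u) u) → ContinuousOn g₀ (Set.Icc (0:ℝ) 1) →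
      ∀ (t : IntegralRep 1), t.domain = Set.pi Set.univ (fun _ : Fin 1 => Set.Icc (0:ℝ) 1) →
      (∀ z ∈ Set.pi Set.univ (fun _ : Fin 1 => Set.Icc (0:ℝ) 1), t.integrand z =
        g₀ (z 0) + ∑ i, c i * ((Polynomial.derivative (p i)).eval (z 0) / (p i).eval (z 0))) →
      t.value = (G₀ 1 - G₀ 0) + ∑ i, c i * Real.log ((p i).eval 1 / (p i).eval 0) := by
  intro s p c G₀ g₀ hp hG hg t ht hti
  have hmeas : MeasurableSet (Set.pi Set.univ (fun _ : Fin 1 => Set.Icc (0:ℝ) 1)) :=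
    MeasurableSet.univ_pi fun _ => measurableSet_Icc
  have hg_int : IntervalIntegrable g₀ volume 0 1 := by
    refine ContinuousOn.intervalIntegrable ?_
    rw [Set.uIcc_of_le zero_le_one]
    exact hg
  have hsum_int : IntervalIntegrable
      (fun u : ℝ => ∑ i, c i * ((Polynomial.derivative (p i)).eval u / (p i).eval u)) volume 0 1 :=
    (continuousOn_finsetSum Finset.univ fun i _ =>
      continuousOn_const.mul (continuousOn_logDeriv_poly (p i) (hp i))).intervalIntegrable
  rw [IntegralRep.value, ht, setIntegral_congr_fun hmeas hti,
    setIntegral_cubePi_one_eq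
      (fun y => g₀ y + ∑ i, c i * ((Polynomial.derivative (p i)).eval y / (p i).eval y)),
    integral_Icc_eq_integral_Ioc, ← intervalIntegral.integral_of_le zero_le_one,
    intervalIntegral.integral_add hg_int hsum_int,
    intervalIntegral.integral_finsetSum (s := Finset.univ)
      (fun i _ => intervalIntegrable_const_mul_logDeriv_poly (c i) (p i) (hp i)),
    intervalIntegral_exactPart_eq_sub hG hg]
  congr 1
  exact Finset.sum_congr rfl fun i _ => intervalIntegral_const_mul_logDeriv_poly (c i) (p i) (hp i)

end Summit.KontsevichZagierPeriods.KontsevichZagierPeriods.Cruxes.StokesGeneration.FibrewiseStokes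

end
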